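import Summits.BirchSwinnertonDyer.BirchSwinnertonDyer.Theorems.AlignedTransportAtTwoMainConjectureOfRankZeroBSDAtTwoCyclotomicLayerRankDichotomy
import HarnessLib

/-!
# Route `AlignedTransportAtTwo`, crux C2 `MainConjectureOfRankZeroBSDAtTwo` (stmt-BirchSwinnertonDyer-22298):
# THE `λ`-BUDGET OF RANK GROWTH — the layers `n+1` of a `ℤ_p`-tower at which `rank E(K_{n+1}) > rank E(K_n)` have total degree `∑ pⁿ(p−1) ≤ λ(X)`

HONEST FRAMING (cell `bsd-f1-sign2`, WIDTH-5 attached prover seat `bsd-line-att-p5` gen 36 on line `birth` of the lead `bsd-line-att-p2`;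
`--supports` stmt-BirchSwinnertonDyer-22298, closes nothing; BSD is NOT proved by any of this; the crux C2, its verdict «blocked-on
`Rank1Residual.GreenbergMuConjectureIrreducible`» and every registered stub are untouched). THEOREMS ONLY — no `def`, no named fact, no `sorry`.
Sequel of `…CyclotomicLayerRankDichotomy` (this gen): there, growth in the layer `K_{n+1}/K_n` puts the PRIME `Ψ_n = Φ_{p^{n+1}}(1+T)` (`λ(Ψ_n) = pⁿ(p−1)`)
into `char_Λ X`. The `Ψ_n` for distinct `n` are NON-ASSOCIATED primes (distinct `λ`), so all of them divide `f_X` SIMULTANEOUSLY: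

* §1 (pure `Λ`-algebra) `prod_cyclotomicLayer_dvd_of_forall_dvd` — `(∀ n ∈ S, Ψ_n ∣ f) ⇒ ∏_{n∈S} Ψ_n ∣ f`; `lam_prod_cyclotomicLayer` — `λ(∏_S Ψ_n) = ∑_S pⁿ(p−1)`;
  `sum_totient_le_lam_of_forall_dvd` — **`f ≠ 0`, `Ψ_n ∣ f` for all `n ∈ S` ⇒ `∑_{n∈S} pⁿ(p−1) ≤ λ(f)`**.
* §2 ★★ `sum_totient_growthLayers_le_lam` — for `E/K` elliptic over a number field, ANY `ℤ_p`-extension with topological generator `γ`, a dual datum with `X`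
  finitely generated and torsion, `char_Λ X = (f_E)`, and ANY finite set `S` of layers with `rank E(K_n) < rank E(K_{n+1})` (`n ∈ S`):
  **`∑_{n∈S} pⁿ(p−1) ≤ λ(f_E) = λ(X)`** — a sharpening of Greenberg's Thm. 1.9 (`rank E(K_n) ≤ λ(X)` for all `n`): growth at a DEEP layer `n+1` alone costs
  `pⁿ(p−1)` of the `λ`-budget, however small the jump; in particular NO growth at any layer `n+1` with `pⁿ(p−1) > λ(X)`
  (`mordellWeilRank_layer_succ_eq_of_lam_lt`), i.e. **the Mordell–Weil rank is stationary from the layer `⌈log_p(λ(X)/(p−1))⌉ + 1` on** — with no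
  hypothesis on the reduction of `E` at `p` and no main conjecture.

References: R. Greenberg, LNM 1716 (1999), Thm. 1.9 (p. 63), §5 p. 132 [GreenbergLNM1716]; L. Washington, GTM 83, §7.1, §13.2 [Washington1997];
M. Kurihara, R. Pollack (2007), §3.1 [KuriharaPollack2007].
-/

set_option linter.dupNamespace false
set_option autoImplicit false

noncomputable section

open scoped Classical Polynomial

namespace Summit.BirchSwinnertonDyer.BirchSwinnertonDyer.Theorems.AlignedTransportAtTwoCyclotomicLayerRankBudget

open Polynomial WeierstrassCurve Literature.NumberTheory.EllipticCurves
  Summit.BirchSwinnertonDyer.Rank1Residual.X1.MuLambda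
  Summit.BirchSwinnertonDyer.Rank1Residual.X1.ParitySqueeze
  Summit.BirchSwinnertonDyer.Rank1Residual.Iwasawa
  Summit.BirchSwinnertonDyer.BirchSwinnertonDyer.Theorems.AlignedTransportAtTwoCyclotomicLayerPrime
  Summit.BirchSwinnertonDyer.BirchSwinnertonDyer.Theorems.AlignedTransportAtTwoCyclotomicLayerRankDichotomy
  Summit.BirchSwinnertonDyer.BirchSwinnertonDyer.Theorems.DefectPrime

universe u

variable {p : ℕ} [hp : Fact p.Prime]

/-! ## §1 Pure `Λ`-algebra: distinct layer primes are non-associated; all of them divide `f` at once; the `λ`-count -/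

/-- Two layer primes dividing one another are equal layers: `Ψ_a ∣ Ψ_b ⇒ a = b` (`Ψ_b` is irreducible and `Ψ_a` is not a unit, so `Ψ_b = Ψ_a·u`; compare
`λ`: `pᵃ(p−1) = pᵇ(p−1)`). [cite: Washington1997, §7.1] -/
theorem eq_of_cyclotomicLayer_dvd {a b : ℕ}
    (h : (((cyclotomic (p ^ (a + 1)) ℤ_[p]).comp (X + 1) : ℤ_[p][X]) : PowerSeries ℤ_[p]) ∣
      (((cyclotomic (p ^ (b + 1)) ℤ_[p]).comp (X + 1) : ℤ_[p][X]) : PowerSeries ℤ_[p])) : a = b := by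
  obtain ⟨u, hu⟩ := h
  have ha := prime_coe_cyclotomic_comp p a
  have hb := prime_coe_cyclotomic_comp p b
  have hunit : IsUnit u := by
    rcases hb.irreducible.isUnit_or_isUnit hu with h1 | h2
    · exact absurd h1 ha.not_unit
    · exact h2
  have hl : lam ((((cyclotomic (p ^ (b + 1)) ℤ_[p]).comp (X + 1) : ℤ_[p][X]) : PowerSeries ℤ_[p])) =
      lam ((((cyclotomic (p ^ (a + 1)) ℤ_[p]).comp (X + 1) : ℤ_[p][X]) : PowerSeries ℤ_[p])) := by
    rw [hu, lam_mul ha.ne_zero hunit.ne_zero, lam_eq_zero_of_isUnit hunit, add_zero]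
  rw [lam_cyclotomicLayer, lam_cyclotomicLayer] at hl
  have hp1 : 0 < p - 1 := by have := hp.out.two_le; omega
  exact (Nat.pow_right_injective hp.out.two_le (Nat.eq_of_mul_eq_mul_right hp1 hl)).symm

/-- **All the layer primes dividing `f` divide it simultaneously**: `(∀ n ∈ S, Ψ_n ∣ f) ⇒ ∏_{n∈S} Ψ_n ∣ f` (induction on `S`: `Ψ_a` prime divides
`f = (∏_S Ψ)·g`, and `Ψ_a ∤ ∏_S Ψ` for `a ∉ S` by `eq_of_cyclotomicLayer_dvd`). [cite: Washington1997, §13.2] -/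
theorem prod_cyclotomicLayer_dvd_of_forall_dvd (S : Finset ℕ) {f : PowerSeries ℤ_[p]}
    (h : ∀ n ∈ S, (((cyclotomic (p ^ (n + 1)) ℤ_[p]).comp (X + 1) : ℤ_[p][X]) : PowerSeries ℤ_[p]) ∣ f) :
    (∏ n ∈ S, (((cyclotomic (p ^ (n + 1)) ℤ_[p]).comp (X + 1) : ℤ_[p][X]) : PowerSeries ℤ_[p])) ∣ f := by
  induction S using Finset.induction_on with
  | empty => simp
  | insert a S haS ih =>
    rw [Finset.prod_insert haS]
    obtain ⟨g, hg⟩ := ih (fun n hn ↦ h n (Finset.mem_insert_of_mem hn))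
    have ha := h a (Finset.mem_insert_self a S)
    rw [hg] at ha
    rcases (prime_coe_cyclotomic_comp p a).dvd_or_dvd ha with h1 | h2
    · exfalso
      obtain ⟨n, hn, hdvd⟩ := (prime_coe_cyclotomic_comp p a).exists_mem_finset_dvd h1
      exact haS ((eq_of_cyclotomicLayer_dvd hdvd) ▸ hn)
    · obtain ⟨g', rfl⟩ := h2
      exact ⟨g', by rw [hg]; ring⟩

/-- `λ(∏_{n∈S} Ψ_n) = ∑_{n∈S} pⁿ(p−1)` (`λ` is additive on non-zero elements). [cite: Washington1997, §7.1] -/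
theorem lam_prod_cyclotomicLayer (S : Finset ℕ) :
    lam (∏ n ∈ S, (((cyclotomic (p ^ (n + 1)) ℤ_[p]).comp (X + 1) : ℤ_[p][X]) : PowerSeries ℤ_[p])) = ∑ n ∈ S, p ^ n * (p - 1) := by
  induction S using Finset.induction_on with
  | empty => simp [lam_eq_zero_of_isUnit isUnit_one]
  | insert a S haS ih =>
    rw [Finset.prod_insert haS, Finset.sum_insert haS, lam_mul (prime_coe_cyclotomic_comp p a).ne_zero
      (Finset.prod_ne_zero_iff.mpr fun n _ ↦ (prime_coe_cyclotomic_comp p n).ne_zero), ih, lam_cyclotomicLayer]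

/-- ★ **`∑_{n∈S} pⁿ(p−1) ≤ λ(f)` whenever `f ≠ 0` and `Ψ_n ∣ f` for every `n ∈ S`** (a divisor of `f` has `λ ≤ λ(f)`). [cite: Washington1997, §7.1 and §13.2] -/
theorem sum_totient_le_lam_of_forall_dvd (S : Finset ℕ) {f : PowerSeries ℤ_[p]} (hf : f ≠ 0)
    (h : ∀ n ∈ S, (((cyclotomic (p ^ (n + 1)) ℤ_[p]).comp (X + 1) : ℤ_[p][X]) : PowerSeries ℤ_[p]) ∣ f) :
    ∑ n ∈ S, p ^ n * (p - 1) ≤ lam f := by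
  obtain ⟨g, hg⟩ := prod_cyclotomicLayer_dvd_of_forall_dvd S h
  have hP0 : (∏ n ∈ S, (((cyclotomic (p ^ (n + 1)) ℤ_[p]).comp (X + 1) : ℤ_[p][X]) : PowerSeries ℤ_[p])) ≠ 0 :=
    Finset.prod_ne_zero_iff.mpr fun n _ ↦ (prime_coe_cyclotomic_comp p n).ne_zero
  have hg0 : g ≠ 0 := by rintro rfl; exact hf (by rw [hg, mul_zero])
  rw [← lam_prod_cyclotomicLayer S, hg, lam_mul hP0 hg0]
  exact Nat.le_add_right _ _

/-! ## §2 The `λ`-budget of the growth layers -/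

section Budget

variable {K : Type u} [Field K] [NumberField K] (W : WeierstrassCurve K) [W.IsElliptic]
  {κ : ZpExtension K p} {γ : Field.absoluteGaloisGroup K}

/-- ★★ **THE `λ`-BUDGET OF RANK GROWTH.** For `E/K` elliptic over a number field, ANY `ℤ_p`-extension `K_∞ = ⋃ K_n` with topological generator `γ`, a dual datum
`D` of `Sel_{p^∞}(E/K_∞)` with `X` finitely generated and `Λ`-torsion, `char_Λ X = (f_E)`, and any finite set `S` of layers with GROWTH
(`rank E(K_n) < rank E(K_{n+1})` for `n ∈ S`): **`∑_{n∈S} pⁿ(p−1) ≤ λ(f_E)`** (`= λ(X)`, tree `lam_generator_eq_lambdaInvariant`). Each growth layer contributes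
its prime `Φ_{p^{n+1}}(1+T)` to `f_E` (the layer dichotomy), the primes are non-associated, and `f_E ≠ 0` (`X` torsion). Sharpens Greenberg's Thm. 1.9
(`rank E(K_n) ≤ λ`): a jump at a deep layer is expensive however small it is. [cite: GreenbergLNM1716, Thm. 1.9 (p. 63) and §5 p. 132] -/
theorem sum_totient_growthLayers_le_lam (hγ : κ.IsTopGenerator γ) (D : W.SelmerDualData κ γ) [Module.Finite (IwasawaAlgebra p) D.X]
    (hD : D.IsTorsion) {fE : IwasawaAlgebra p} (hfE : D.charIdeal = Ideal.span {fE}) (S : Finset ℕ)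
    (hS : ∀ n ∈ S, (W.baseChange (κ.layer n)).mordellWeilRank < (W.baseChange (κ.layer (n + 1))).mordellWeilRank) :
    ∑ n ∈ S, p ^ n * (p - 1) ≤ lam fE := by
  have hfE0 : fE ≠ 0 := by
    intro h0
    refine Module.charIdeal_ne_bot (IwasawaAlgebra p) D.X ?_
    change D.charIdeal = ⊥
    rw [hfE, h0]
    exact Ideal.span_singleton_eq_bot.mpr rfl
  refine sum_totient_le_lam_of_forall_dvd S hfE0 fun n hn ↦ ?_
  rcases mordellWeilRank_layer_succ_eq_or_cyclotomicLayer_dvd_charGen W hγ D hD hfE n with h | h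
  · exact absurd h (hS n hn).ne'
  · exact h

/-- In the tree's invariant: `∑_{n∈S} pⁿ(p−1) ≤ λ(X)` (`lambdaInvariant`). [cite: GreenbergLNM1716, Thm. 1.9 (p. 63) and §5 p. 132] -/
theorem sum_totient_growthLayers_le_lambdaInvariant (hγ : κ.IsTopGenerator γ) (D : W.SelmerDualData κ γ)
    [Module.Finite (IwasawaAlgebra p) D.X] (hD : D.IsTorsion) {fE : IwasawaAlgebra p} (hfE : D.charIdeal = Ideal.span {fE}) (S : Finset ℕ)
    (hS : ∀ n ∈ S, (W.baseChange (κ.layer n)).mordellWeilRank < (W.baseChange (κ.layer (n + 1))).mordellWeilRank) :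
    ∑ n ∈ S, p ^ n * (p - 1) ≤ lambdaInvariant p D.X := by
  have hfE0 : fE ≠ 0 := by
    intro h0
    refine Module.charIdeal_ne_bot (IwasawaAlgebra p) D.X ?_
    change D.charIdeal = ⊥
    rw [hfE, h0]
    exact Ideal.span_singleton_eq_bot.mpr rfl
  rw [← lam_generator_eq_lambdaInvariant D.X hD hfE0 hfE]
  exact sum_totient_growthLayers_le_lam W hγ D hD hfE S hS

/-- ★ **NO GROWTH BEYOND THE `λ`-BUDGET: `pⁿ(p−1) > λ(f_E) ⇒ rank E(K_{n+1}) = rank E(K_n)`** — the Mordell–Weil rank in ANY `ℤ_p`-tower of a number field is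
stationary from the layer `n+1` on as soon as `pⁿ(p−1)` exceeds `λ(X)`; no hypothesis on the reduction of `E`, no main conjecture. [cite: GreenbergLNM1716, Thm. 1.9 (p. 63) and §5 p. 132] -/
theorem mordellWeilRank_layer_succ_eq_of_lam_lt (hγ : κ.IsTopGenerator γ) (D : W.SelmerDualData κ γ)
    [Module.Finite (IwasawaAlgebra p) D.X] (hD : D.IsTorsion) {fE : IwasawaAlgebra p} (hfE : D.charIdeal = Ideal.span {fE}) {n : ℕ}
    (hn : lam fE < p ^ n * (p - 1)) :
    (W.baseChange (κ.layer (n + 1))).mordellWeilRank = (W.baseChange (κ.layer n)).mordellWeilRank := by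
  by_contra hne
  have hlt : (W.baseChange (κ.layer n)).mordellWeilRank < (W.baseChange (κ.layer (n + 1))).mordellWeilRank :=
    lt_of_le_of_ne (mordellWeilRank_layer_le_succ W κ n) (Ne.symm hne)
  have h := sum_totient_growthLayers_le_lam W hγ D hD hfE {n} (by simpa using hlt)
  rw [Finset.sum_singleton] at h
  omega

/-- **Stationary from `n₀` on**: if `λ(f_E) < p^{n₀}(p−1)` then `rank E(K_m) = rank E(K_{n₀})` for every `m ≥ n₀` — Greenberg's «`E(K_∞)` is finitely generated»
consequence of Thm. 1.9 with an EXPLICIT stabilisation layer. [cite: GreenbergLNM1716, Thm. 1.9 (p. 63)] -/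
theorem mordellWeilRank_layer_eq_of_lam_lt (hγ : κ.IsTopGenerator γ) (D : W.SelmerDualData κ γ)
    [Module.Finite (IwasawaAlgebra p) D.X] (hD : D.IsTorsion) {fE : IwasawaAlgebra p} (hfE : D.charIdeal = Ideal.span {fE}) {n₀ : ℕ}
    (hn₀ : lam fE < p ^ n₀ * (p - 1)) {m : ℕ} (hm : n₀ ≤ m) :
    (W.baseChange (κ.layer m)).mordellWeilRank = (W.baseChange (κ.layer n₀)).mordellWeilRank := by
  induction m, hm using Nat.le_induction with
  | base => rfl
  | succ m hm ih =>
    have hlt : lam fE < p ^ m * (p - 1) :=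
      lt_of_lt_of_le hn₀ (Nat.mul_le_mul_right _ (Nat.pow_le_pow_right hp.out.pos hm))
    rw [mordellWeilRank_layer_succ_eq_of_lam_lt W hγ D hD hfE hlt, ih]

/-- **Cyclotomic tower over a number field, no finiteness hypothesis.** [cite: GreenbergLNM1716, Thm. 1.9 (p. 63) and §1 p. 60] -/
theorem sum_totient_growthLayers_le_lam_of_isCyclotomic (hκ : κ.IsCyclotomic) (hγ : κ.IsTopGenerator γ) (D : W.SelmerDualData κ γ)
    (hD : D.IsTorsion) {fE : IwasawaAlgebra p} (hfE : D.charIdeal = Ideal.span {fE}) (S : Finset ℕ)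
    (hS : ∀ n ∈ S, (W.baseChange (κ.layer n)).mordellWeilRank < (W.baseChange (κ.layer (n + 1))).mordellWeilRank) :
    ∑ n ∈ S, p ^ n * (p - 1) ≤ lam fE := by
  haveI : Module.Finite (IwasawaAlgebra p) D.X := D.module_finite_of_isCyclotomic W κ hκ hγ
  exact sum_totient_growthLayers_le_lam W hγ D hD hfE S hS

end Budget

end Summit.BirchSwinnertonDyer.BirchSwinnertonDyer.Theorems.AlignedTransportAtTwoCyclotomicLayerRankBudget
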